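import Summits.NavierStokesRegularity.NavierStokesRegularity.Theses.SqueezeCycle
import Summits.NavierStokesRegularity.NavierStokesRegularity.Theses.RecurrentProfiles
import Summits.NavierStokesRegularity.NavierStokesRegularity.Theses.RellichScar
import Summits.NavierStokesRegularity.NavierStokesRegularity.Theorems.RecurrentLiouville.Negative.KillCriterion
import Summits.NavierStokesRegularity.NavierStokesRegularity.Theorems.ApexLocalisation.Negative.LogicAndLoadBearing
import HarnessLib

/-!
# Crux `RecurrentLiouville` (stmt-NavierStokesRegularity-1589), line `Sketch` — the residue, BY ITEM NAME

Theorems-only `--supports` helper (lead c5) for the reshaped skeleton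
`Cruxes/RecurrentLiouville/Lines/Sketch.lean`, whose two registered stubs are now VERBATIM the open
items stmt-NavierStokesRegularity-11719 `Theses.RellichScar.ApexLocalisation` and
stmt-NavierStokesRegularity-11716 `Theses.RellichScar.NoApexTypeIProfile`.  This file proves that the
reshape neither loses nor adds strength, by decl name, across the three routes that meet here:

* `recurrentLiouville_iff_noTypeIRateProfile` : the crux (`Theses.SqueezeCycle.RecurrentLiouville`
  = `Theses.RecurrentProfiles.RecurrentLiouville`) is EQUIVALENT to RecurrentProfiles' TARGET
  `Theses.RecurrentProfiles.NoTypeIRateProfile` (stmt-NavierStokesRegularity-1588) — recurrence is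
  not load-bearing (positive form of `RecurrentLiouville.Negative.noTypeIRateProfile_false_iff`, which
  rests on the PROVED reduction `recurrentReduction_proof`, item 1590);
* `noTypeIRateProfile_iff_rellichScar` : that target is EXACTLY `NoApexTypeIProfile ∧ ApexLocalisation`
  (positive, by-name form of `ApexLocalisation.Negative.not_rateProfileExists_iff_target_and_crux`);
* `recurrentLiouville_iff_rellichScar` : hence **crux ↔ NoApexTypeIProfile ∧ ApexLocalisation** —
  the two reshaped stubs are jointly necessary and sufficient; `recurrentLiouville_of_rellichScar` is
  the skeleton's composition with the stubs as hypotheses, and `rellichScar_of_recurrentLiouville`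
  says that any proof of the crux proves both RellichScar items.

Registered tools stub: `stub_rsRellichScarResidueTools` (the conjunction of the three equivalences).

## References

* D. Albritton, T. Barker, J. Math. Fluid Mech. 21 (2019) = arXiv:1811.00502, Thm. 1.1, §3. [AlbrittonBarker2019]
* G. Koch, N. Nadirashvili, G. Seregin, V. Šverák, Acta Math. 203 (2009), (1.6). [KNSS2009]
-/

noncomputable section

-- the sub-problem namespace repeats the summit name (D-0017 layout `Summit.<S>.<P>.Theorems`)
set_option linter.dupNamespace false

namespace Summit.NavierStokesRegularity.NavierStokesRegularity.Theorems

open Summit.NavierStokesRegularity.NavierStokesRegularity.Theses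

/-- **Recurrence is not load-bearing (positive form)**: the crux is equivalent to RecurrentProfiles'
target "no Type-I-rate singular profile" (stmt-NavierStokesRegularity-1588).
[cite: AlbrittonBarker2019, Thm. 1.1 and §3] -/
theorem recurrentLiouville_iff_noTypeIRateProfile :
    SqueezeCycle.RecurrentLiouville ↔ RecurrentProfiles.NoTypeIRateProfile :=
  (not_iff_not.1 RecurrentLiouville.Negative.noTypeIRateProfile_false_iff).symm

/-- RecurrentProfiles' target says that the rate-profile class of route RellichScar is empty
(the two existence statements differ only in binder order). [folklore] -/
theorem noTypeIRateProfile_iff_not_rateProfileExists :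
    RecurrentProfiles.NoTypeIRateProfile ↔ ¬ ApexLocalisation.Negative.RateProfileExists := by
  constructor
  · rintro h ⟨C, u, p, G, hsw, hwg, hI, hdec, hsing⟩
    exact h u p G C hsw hwg hI hdec hsing
  · intro h u p G C hsw hwg hI hdec hsing
    exact h ⟨C, u, p, G, hsw, hwg, hI, hdec, hsing⟩

/-- **"No rate profile" is exactly target + crux of route RellichScar**, by name:
`NoTypeIRateProfile ↔ NoApexTypeIProfile ∧ ApexLocalisation`. [cite: KNSS2009, (1.6)] -/
theorem noTypeIRateProfile_iff_rellichScar :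
    RecurrentProfiles.NoTypeIRateProfile ↔
      (RellichScar.NoApexTypeIProfile ∧ RellichScar.ApexLocalisation) :=
  noTypeIRateProfile_iff_not_rateProfileExists.trans
    ApexLocalisation.Negative.not_rateProfileExists_iff_target_and_crux

/-- **The crux is exactly the conjunction of the two reshaped stubs**:
`RecurrentLiouville ↔ NoApexTypeIProfile ∧ ApexLocalisation` (items 11716 ∧ 11719 of route
RellichScar).  Neither item alone is known; both are research-open.
[cite: AlbrittonBarker2019, Thm. 1.1 and §3] [cite: KNSS2009, (1.6)] -/
theorem recurrentLiouville_iff_rellichScar :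
    SqueezeCycle.RecurrentLiouville ↔
      (RellichScar.NoApexTypeIProfile ∧ RellichScar.ApexLocalisation) :=
  recurrentLiouville_iff_noTypeIRateProfile.trans noTypeIRateProfile_iff_rellichScar

/-- The skeleton's composition with the stubs as hypotheses: apex localisation upgrades an
origin-singular class profile to an origin-singular apex-class profile, apex-class Type-I
Liouville excludes it (recurrence forgotten). [cite: KNSS2009, (1.6)] -/
theorem recurrentLiouville_of_rellichScar (hX : RellichScar.NoApexTypeIProfile)
    (hA : RellichScar.ApexLocalisation) : SqueezeCycle.RecurrentLiouville :=
  recurrentLiouville_iff_rellichScar.2 ⟨hX, hA⟩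

/-- Any proof of the crux proves BOTH RellichScar items: the target (apex ⊆ rate; recurrence
re-supplied by the proved reduction) and the apex-localisation crux (vacuously: under the crux no
rate profile exists). [cite: AlbrittonBarker2019, Thm. 1.1 and §3] -/
theorem rellichScar_of_recurrentLiouville (hL : SqueezeCycle.RecurrentLiouville) :
    RellichScar.NoApexTypeIProfile ∧ RellichScar.ApexLocalisation :=
  recurrentLiouville_iff_rellichScar.1 hL

/-- **Registered tools stub of line `Sketch` (lead c5)**: the residue of the crux by item name —
crux ↔ RecurrentProfiles' target ↔ (RellichScar target ∧ RellichScar apex-localisation crux).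
[cite: AlbrittonBarker2019, Thm. 1.1 and §3] [cite: KNSS2009, (1.6)] -/
theorem stub_rsRellichScarResidueTools :
    (SqueezeCycle.RecurrentLiouville ↔ RecurrentProfiles.NoTypeIRateProfile) ∧
    (RecurrentProfiles.NoTypeIRateProfile ↔
      (RellichScar.NoApexTypeIProfile ∧ RellichScar.ApexLocalisation)) ∧
    (SqueezeCycle.RecurrentLiouville ↔
      (RellichScar.NoApexTypeIProfile ∧ RellichScar.ApexLocalisation)) :=
  ⟨recurrentLiouville_iff_noTypeIRateProfile, noTypeIRateProfile_iff_rellichScar,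
    recurrentLiouville_iff_rellichScar⟩

end Summit.NavierStokesRegularity.NavierStokesRegularity.Theorems

end
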